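import Summits.QuantumAdvantage.QuantumAdvantage.Theorems.SosSandwichPseudoBoundedAAApproxBooleanCorner
import Summits.QuantumAdvantage.QuantumAdvantage.Theses.RandomOracleGauge
import HarnessLib

/-!
# Crux `AAConj` (stmt-QuantumAdvantage-10748) / `PseudoBoundedAA` (15237) — the TOP-VARIANCE regime `ε = 1/4` of the
# Aaronson–Ambainis conjecture is the (balanced) Boolean corner, and holds

For a `[0,1]`-valued cube function, `Var[p] = E[p²] − (E p)² ≤ E p − (E p)² ≤ 1/4`, with `Var[p] = 1/4` iff `p` is
`{0,1}`-valued and balanced.  Hence the body of the route decl `AAConj` at the top admissible variance `ε = 1/4` concerns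
exactly Boolean polynomials, where the conjecture is the OSSS/Nisan–Szegedy/Beals et al. theorem: by
`…ApproxBooleanCorner.exists_influence_ge_of_approx_boolean` (with approximation error `0`),
`∃ j, Var[p]²/(1024 d¹²) ≤ Inf_j[p]`.

* `boolVariance_le_avg_sub_sq` (`Var ≤ E p − (E p)²`), `boolean_of_topVariance` (`Var ≥ 1/4 ⟹ p ∈ {0,1}` on the cube),
* `aaConj_topVariance` — `[0,1]`-bounded `p` of degree `≤ d` (`d ≥ 1`) with `Var[p] ≥ 1/4`: `∃ j, 1/(16384 d¹²) ≤ Inf_j`,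
* `aaConj_regime_top` — the body of `AAConj` with `ε = 1/4`, `(c, C) = (12, 1/1024)`:
  `∃ j, (1/1024)((1/4)/d)¹² ≤ Inf_j[p]`.

So for all three open decls of the chain (`stub_l1Family` — `…L1FamilyTopMass`; `DecoupledCoreAA` — `…TopVariance`;
`AAConj` — here) the top regime is the Boolean corner and is proved; the conjecture is the robustness below the ceiling.
Honest label: a known corner; no stub, crux or summit is closed.  Sources: O'Donnell–Saks–Schramm–Servedio 2005;
Nisan–Szegedy 1994; Beals et al. 2001; Aaronson–Ambainis arXiv:0911.0996 Conj. 6 / Thm 1.9 (Boolean case).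
-/

-- D-0017: single-conjunct summit ⇒ the duplicate `QuantumAdvantage.QuantumAdvantage` is mandated.
set_option linter.dupNamespace false

noncomputable section

open Finset
open Literature.Computability.Complexity Literature.Computability.QuantumComplexity
open Summit.QuantumAdvantage.QuantumAdvantage.Theorems.SosSandwich.ApproxBooleanCorner
  (exists_influence_ge_of_approx_boolean)
open Summit.QuantumAdvantage.QuantumAdvantage.Cruxes.DecoupledCoreAA.L1Family.Poincare (boolVariance_eq_sq_sub)

namespace Summit.QuantumAdvantage.QuantumAdvantage.Theorems.RandomOracleGauge.AAConjTopVariance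

variable {N : ℕ}

/-- **`Var[p] ≤ E p − (E p)²`** for `[0,1]`-valued `p` (`p² ≤ p` pointwise). [folklore] -/
theorem boolVariance_le_avg_sub_sq (p : MvPolynomial (Fin N) ℝ) (hb : ∀ x, 0 ≤ evalBool p x ∧ evalBool p x ≤ 1) :
    boolVariance p ≤ boolAvg (evalBool p) - boolAvg (evalBool p) ^ 2 := by
  rw [boolVariance_eq_sq_sub]
  have h : boolAvg (fun z => evalBool p z ^ 2) ≤ boolAvg (evalBool p) := by
    unfold boolAvg
    refine div_le_div_of_nonneg_right (Finset.sum_le_sum fun x _ => ?_) (by positivity)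
    have := hb x
    nlinarith [this.1, this.2]
  linarith

/-- **Top variance forces Boolean values**: a `[0,1]`-valued `p` with `Var[p] ≥ 1/4` is `{0,1}`-valued on the cube
(`1/4 ≤ E p − (E p)² ≤ 1/4` forces `E[p − p²] = 0` with `p − p² ≥ 0` pointwise). [folklore] -/
theorem boolean_of_topVariance (p : MvPolynomial (Fin N) ℝ) (hb : ∀ x, 0 ≤ evalBool p x ∧ evalBool p x ≤ 1)
    (hv : 1 / 4 ≤ boolVariance p) : ∀ x, evalBool p x = 0 ∨ evalBool p x = 1 := by
  have hVle := boolVariance_le_avg_sub_sq p hb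
  set m := boolAvg (evalBool p) with hm
  -- `E p − (E p)² ≤ 1/4`, so everything is tight: `E[p²] = E[p]`
  have hm4 : m - m ^ 2 ≤ 1 / 4 := by nlinarith [sq_nonneg (m - 1 / 2)]
  have hsq : boolAvg (fun z => evalBool p z ^ 2) = m := by
    have h1 : boolAvg (fun z => evalBool p z ^ 2) ≤ m := by
      unfold boolAvg; rw [hm]; unfold boolAvg
      refine div_le_div_of_nonneg_right (Finset.sum_le_sum fun x _ => ?_) (by positivity)
      have := hb x
      nlinarith [this.1, this.2]
    have h2 : m ≤ boolAvg (fun z => evalBool p z ^ 2) := by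
      rw [boolVariance_eq_sq_sub] at hv
      nlinarith [sq_nonneg (m - 1 / 2)]
    exact le_antisymm h1 h2
  -- hence `Σ_x (p − p²) = 0` with nonnegative terms
  have h2N : (0 : ℝ) < (2 : ℝ) ^ N := by positivity
  have hsum : ∑ x, (evalBool p x - evalBool p x ^ 2) = 0 := by
    have e1 : ∑ x, evalBool p x = m * (2 : ℝ) ^ N := by
      rw [hm]; unfold boolAvg; field_simp
    have e2 : ∑ x, evalBool p x ^ 2 = m * (2 : ℝ) ^ N := by
      rw [← hsq]; unfold boolAvg; field_simp
    rw [Finset.sum_sub_distrib, e1, e2, sub_self]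
  have hnn : ∀ x ∈ (Finset.univ : Finset (Fin N → Bool)), 0 ≤ evalBool p x - evalBool p x ^ 2 := by
    intro x _
    have := hb x
    nlinarith [this.1, this.2]
  intro x
  have h0 := (Finset.sum_eq_zero_iff_of_nonneg hnn).mp hsum x (Finset.mem_univ x)
  have : evalBool p x * (1 - evalBool p x) = 0 := by nlinarith [h0]
  rcases mul_eq_zero.mp this with h | h
  · left; exact h
  · right; linarith

/-- **Aaronson–Ambainis at the variance ceiling.**  A `[0,1]`-bounded `p` of degree `≤ d` (`d ≥ 1`) with
`Var[p] ≥ 1/4` is Boolean, so `∃ j, 1/(16384 d¹²) ≤ Inf_j[p]` (approximately-Boolean corner with error `0`).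
[cite: OdonnellEtAl2005, Thm 3.2] [cite: BealsEtAl2001, Thm 4.13] -/
theorem aaConj_topVariance {d : ℕ} (p : MvPolynomial (Fin N) ℝ) (hd : 1 ≤ d) (hdeg : p.totalDegree ≤ d)
    (hb : ∀ x, 0 ≤ evalBool p x ∧ evalBool p x ≤ 1) (hv : 1 / 4 ≤ boolVariance p) :
    ∃ j : Fin N, 1 / (16384 * (d : ℝ) ^ 12) ≤ influence j p := by
  classical
  have h01 := boolean_of_topVariance p hb hv
  set f : (Fin N → Bool) → Bool := fun x => decide (evalBool p x = 1) with hf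
  have happ : ∀ x, |evalBool p x - realOf f x| ≤ 0 := by
    intro x
    rw [realOf_apply]
    rcases h01 x with h | h
    · rw [h]; simp [hf, h]
    · rw [h]; simp [hf, h]
  have hvpos : 0 < boolVariance p := lt_of_lt_of_le (by norm_num) hv
  have hvar0 : 4 * (0 : ℝ) ^ 2 ≤ boolVariance p := by norm_num; exact hvpos.le
  obtain ⟨j, hj⟩ := exists_influence_ge_of_approx_boolean p hdeg hb f (by norm_num : (0 : ℝ) ≤ 1 / 3) happ
    hvar0 hvpos
  refine ⟨j, le_trans ?_ hj⟩
  have hd0 : (0 : ℝ) < (d : ℝ) := by exact_mod_cast hd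
  have hsq : (1 / 16 : ℝ) ≤ boolVariance p ^ 2 := by nlinarith
  rw [div_le_div_iff₀ (by positivity) (by positivity)]
  nlinarith [pow_pos hd0 12]

/-- **The body of the route decl `AAConj` HOLDS at `ε = 1/4`** (its top admissible variance; `(c, C) = (12, 1/1024)`):
for all `N`, `d ≥ 1`, `[0,1]`-bounded `p` of degree `≤ d` with `1/4 ≤ Var[p]`, some variable has
`(1/1024)·((1/4)/d)¹² ≤ Inf_j[p]`.  The conjecture is this statement's robustness to all `0 < ε ≤ Var[p]`.
[cite: AaronsonAmbainis2014, Conj. 6] [cite: OdonnellEtAl2005, Thm 3.2] -/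
theorem aaConj_regime_top (N d : ℕ) (p : MvPolynomial (Fin N) ℝ) (hd : 1 ≤ d) (hdeg : p.totalDegree ≤ d)
    (hb : ∀ x, 0 ≤ evalBool p x ∧ evalBool p x ≤ 1) (hεV : (1 / 4 : ℝ) ≤ boolVariance p) :
    ∃ j : Fin N, 1 / 1024 * ((1 / 4 : ℝ) / d) ^ 12 ≤ influence j p := by
  obtain ⟨j, hj⟩ := aaConj_topVariance p hd hdeg hb hεV
  refine ⟨j, le_trans ?_ hj⟩
  have hd0 : (0 : ℝ) < (d : ℝ) := by exact_mod_cast hd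
  have hd12 : (0 : ℝ) < (d : ℝ) ^ 12 := by positivity
  rw [div_pow, show (1 : ℝ) / 1024 * ((1 / 4) ^ 12 / (d : ℝ) ^ 12) = (1 / 1024 * (1 / 4) ^ 12) / (d : ℝ) ^ 12 by ring,
    show (1 : ℝ) / (16384 * (d : ℝ) ^ 12) = (1 / 16384) / (d : ℝ) ^ 12 by field_simp]
  exact div_le_div_of_nonneg_right (by norm_num) hd12.le

end Summit.QuantumAdvantage.QuantumAdvantage.Theorems.RandomOracleGauge.AAConjTopVariance

end
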